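import Summits.QuantumFields.YangMills.Theorems.BalabanLadderNTMirrorSplit
import Summits.QuantumFields.YangMills.Theorems.BalabanLadderNTMarkovMirrorBareConverse
import HarnessLib

/-!
# Crux `NT` / seam `UVSeamRec.stub_floorsEngine` (S-B), residual MF: the MIRROR σ-SPLIT and the RP LOCALISER on
# Wilson's odd torus (card `block-sigma-algebra-mirror-split`, kernel-checked in the tree)

Helper file (`--supports stmt-QuantumFields-20043`; owner RULINGS R78/R87) of the fleet lead `ym-spine-19353-p1`,
torus sequel of `…NTMirrorSplit`.
WHICH CLAUSE IT SUPPLIES: the bare lattice mirror floor **MF(4ε)** `4ε ≤ Cov_T(Ṽ_v∘Θ₀, Ṽ_v)` — the R87 residual of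
record of conjunct 2 (two-point floor) of the REGISTERED `UVSeamRec.stub_floorsEngine` (consumed by p517197 /
p518416).

WHAT IS PROVED (Wilson's measure on the odd torus `(ℤ/(2L+1))⁴`, `Θ' = GaugeConfig.negReflect`, observables of the
periodic lift; general compact `G`, any lattice representation `r`):
* `torus_mirror_split` (every `β`, every torus) — for a `Θ'`-EQUIVARIANT coarse-graining `π` of the torus gauge
  fields (`π(Θ'U) = θ(πU)`; the card: Bałaban's last-scale block field) and `g = E_T[W∘lift | σ(π)]`:
  `Cov_T(W∘Θ₀, W) = Cov_T(g∘Θ', g) + E_T[(W∘lift∘Θ' − g∘Θ')(W∘lift − g)]`;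
* **`torus_mirror_floor_of_localiser`** (`β ≥ 0`, `L ≥ 1`, `W` a cylinder in a positive-time window, `h` ANY bounded
  `σ(π)`-measurable functional of the closed positive half centred on `W`):
  `Cov_T(W∘Θ₀, W) ≥ Cov_T(h∘Θ', h) − 2·|Cov_T(h∘Θ', g − h)|` — the conditional (UV) fluctuation term needs NO
  bound: it is an RP square (`CurvatureKernel.oddTorusCov_integral_negReflect_mul_self_nonneg`);
* `torus_mirror_floor_of_posHalf` — the σ-algebra-free special case (`π = id`, `g = W∘lift`);
* `torus_two_abs_crossCov_le` — `2·|Cov_T(h∘Θ', g − h)| ≤ t·Var_T(h) + t⁻¹·E_T[(g − h)²]`: (LXB) from ONE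
  variance (LVB) and ONE mean-square localisation error (LL2), no two-point input.

So MF(4ε) follows from (LMF) `X ≤ Cov_T(h∘Θ', h)` and (LXB) `|Cov_T(h∘Θ', g − h)| ≤ ρ` with `4ε ≤ X − 2ρ`; the
packaging along a unit map and the press-button onto the registered `stub_floorsEngine` text are the sequel
`…UVSeamRecFloorsEngineOfMirrorSplit`.

HONEST FRAMING.  A SUPPLY CURRENCY for MF typed as kernel-checked identities/implications; (LMF) for the pinned
block-field localiser and (LXB) are engine-grade OPEN (barrier `PerturbativeInvisibility`).  Nothing here asserts MF,
NT, the seam or a mass gap. [cite: OsterwalderSeiler1978, §2; GlimmJaffe1987, §6.1]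
-/

set_option autoImplicit false

noncomputable section

open MeasureTheory Filter Topology

namespace Summit.QuantumFields.YangMills.Cruxes.NT.MirrorSplit

/-! ## §2 The torus instance: Wilson's measure on the odd torus, `Θ' = negReflect`, lifted observables -/

section Torus

open Literature.MathematicalPhysics.QuantumFieldTheory Literature.MathematicalPhysics.QuantumLattice
open Summit.QuantumFields.YangMills.Cruxes.OSLegsFromFemtoAndGap.DlrCollarTransfer
open Summit.QuantumFields.YangMills.Cruxes.NT.MarkovMirror (dependsOn_posHalf_of_window dependsOn_strictHalf_of_posHalf)
open Summit.QuantumFields.YangMills.Theorems.CurvatureKernel (oddTorusCov_integral_negReflect_mul_self_nonneg)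

variable (G : Type) [Group G] [TopologicalSpace G] [IsTopologicalGroup G] [CompactSpace G]
  [MeasurableSpace G] [BorelSpace G] (r : LatticeRep G)

/-- **The torus mirror split.**  For a coarse-graining map `π` of the torus gauge fields into any measurable space
that is EQUIVARIANT under the site reflection (`π (Θ'U) = θ (π U)`, `θ` measurable — so `σ(π)` is `Θ'`-invariant,
`measurable_comap_of_equivariant`; the card: `π =` Bałaban's last-scale block field, `θ =` its reflection) and a
bounded continuous observable `W` of the periodic lift, with `g = E_T[W∘lift | σ(π)]`:
`Cov_T(W∘Θ₀, W) = Cov_T(g∘Θ', g) + E_T[(W∘lift∘Θ' − g∘Θ')(W∘lift − g)]`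
(`mirror_split` with `measurePreserving_negReflect_wilsonMeasure`, `negReflect_negReflect_config`,
`torusLift_negReflect`; every coupling, every torus). [cite: GlimmJaffe1987, §6.1] -/
theorem torus_mirror_split (β : ℝ) (L : ℕ) {Y : Type*} [MeasurableSpace Y]
    {π : GaugeConfig 4 (2 * L + 1) G → Y} (hπ : Measurable π) {θ : Y → Y} (hθ : Measurable θ)
    (heq : ∀ U, π (GaugeConfig.negReflect U) = θ (π U))
    {W : LGConfig 4 G → ℝ} (hWc : Continuous W) {MW : ℝ} (hMW : ∀ U, |W U| ≤ MW) :
    torusE G r β L (fun V => W (cfgReflect V) * W V) -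
        torusE G r β L (fun V => W (cfgReflect V)) * torusE G r β L W =
      ((∫ U, ((wilsonMeasure (d := 4) (L := 2 * L + 1) r.ρ β)[fun U => W (torusLift (2 * L + 1) U)|
              MeasurableSpace.comap π inferInstance]) U.negReflect *
          ((wilsonMeasure (d := 4) (L := 2 * L + 1) r.ρ β)[fun U => W (torusLift (2 * L + 1) U)|
              MeasurableSpace.comap π inferInstance]) U
          ∂(wilsonMeasure (d := 4) (L := 2 * L + 1) r.ρ β)) -
        (∫ U, ((wilsonMeasure (d := 4) (L := 2 * L + 1) r.ρ β)[fun U => W (torusLift (2 * L + 1) U)|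
              MeasurableSpace.comap π inferInstance]) U.negReflect
            ∂(wilsonMeasure (d := 4) (L := 2 * L + 1) r.ρ β)) *
        (∫ U, ((wilsonMeasure (d := 4) (L := 2 * L + 1) r.ρ β)[fun U => W (torusLift (2 * L + 1) U)|
              MeasurableSpace.comap π inferInstance]) U
            ∂(wilsonMeasure (d := 4) (L := 2 * L + 1) r.ρ β))) +
      ∫ U, (W (torusLift (2 * L + 1) U.negReflect) -
          ((wilsonMeasure (d := 4) (L := 2 * L + 1) r.ρ β)[fun U => W (torusLift (2 * L + 1) U)|
              MeasurableSpace.comap π inferInstance]) U.negReflect) *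
        (W (torusLift (2 * L + 1) U) -
          ((wilsonMeasure (d := 4) (L := 2 * L + 1) r.ρ β)[fun U => W (torusLift (2 * L + 1) U)|
              MeasurableSpace.comap π inferInstance]) U)
        ∂(wilsonMeasure (d := 4) (L := 2 * L + 1) r.ρ β) := by
  haveI := isProbabilityMeasure_wilsonMeasure (d := 4) (L := 2 * L + 1) r.ρ r.continuous β
  haveI := r.secondCountableTopology
  have key := mirror_split (m := MeasurableSpace.comap π inferInstance)
    (wilsonMeasure (d := 4) (L := 2 * L + 1) r.ρ β) hπ.comap_le
    (measurePreserving_negReflect_wilsonMeasure (d := 4) (L := 2 * L + 1) r.ρ r.continuous β)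
    WilsonSiteRP.negReflect_negReflect_config
    (measurable_comap_of_equivariant π GaugeConfig.negReflect θ hθ heq)
    (f := fun U => W (torusLift (2 * L + 1) U)) ((hWc.comp (continuous_torusLift _)).measurable) (fun U => hMW _)
  unfold torusE
  simp only [torusLift_negReflect] at key ⊢
  exact key

/-- **The torus mirror floor by RP localisation.**  On the torus `2L+1` (`L ≥ 1`, `β ≥ 0`): `π` a `Θ'`-equivariant
coarse-graining of the torus gauge fields, `W` a bounded continuous cylinder observable with links at times in
`[0, L−1]` (read through the periodic lift), `h` ANY bounded `σ(π)`-measurable functional of the closed positive half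
with `∫ h dμ_T = E_T[W]`; then with `g = E_T[W∘lift | σ(π)]`:
`Cov_T(W∘Θ₀, W) ≥ Cov_T(h∘Θ', h) − 2·|Cov_T(h∘Θ', g − h)|`
— `mirror_floor_of_localiser`, the RP square supplied by `CurvatureKernel.oddTorusCov_integral_negReflect_mul_self_nonneg`
(`W∘lift − h` is a positive-half observable).  The conditional fluctuation term needs no bound.
[cite: OsterwalderSeiler1978, §2] -/
theorem torus_mirror_floor_of_localiser {β : ℝ} (hβ : 0 ≤ β) {L : ℕ} (hL : 1 ≤ L) {Y : Type*} [MeasurableSpace Y]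
    {π : GaugeConfig 4 (2 * L + 1) G → Y} (hπ : Measurable π) {θ : Y → Y} (hθ : Measurable θ)
    (heq : ∀ U, π (GaugeConfig.negReflect U) = θ (π U))
    {W : LGConfig 4 G → ℝ} (hWc : Continuous W) {MW : ℝ} (hMW : ∀ U, |W U| ≤ MW)
    {SW : Finset (Literature.MathematicalPhysics.QuantumLattice.ZdEdge 4)} (hWS : IsCylinder W SW)
    (hSW : ∀ e ∈ SW, 0 ≤ e.1 0 ∧ e.1 0 + 1 ≤ (L : ℤ))
    {h : GaugeConfig 4 (2 * L + 1) G → ℝ} (hh : Measurable[MeasurableSpace.comap π inferInstance] h)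
    {K : ℝ} (hK : ∀ U, |h U| ≤ K)
    (hdep : DependsOn h {e : Edge 4 (2 * L + 1) | (e.1 0).val ≤ L ∧ ((e.1.shift e.2) 0).val ≤ L})
    (hcent : ∫ U, h U ∂(wilsonMeasure (d := 4) (L := 2 * L + 1) r.ρ β) = torusE G r β L W) :
    ((∫ U, h U.negReflect * h U ∂(wilsonMeasure (d := 4) (L := 2 * L + 1) r.ρ β)) -
        (∫ U, h U.negReflect ∂(wilsonMeasure (d := 4) (L := 2 * L + 1) r.ρ β)) *
          (∫ U, h U ∂(wilsonMeasure (d := 4) (L := 2 * L + 1) r.ρ β))) -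
        2 * |(∫ U, h U.negReflect *
              (((wilsonMeasure (d := 4) (L := 2 * L + 1) r.ρ β)[fun U => W (torusLift (2 * L + 1) U)|
                  MeasurableSpace.comap π inferInstance]) U - h U)
              ∂(wilsonMeasure (d := 4) (L := 2 * L + 1) r.ρ β)) -
            (∫ U, h U.negReflect ∂(wilsonMeasure (d := 4) (L := 2 * L + 1) r.ρ β)) *
              (∫ U, (((wilsonMeasure (d := 4) (L := 2 * L + 1) r.ρ β)[fun U => W (torusLift (2 * L + 1) U)|
                  MeasurableSpace.comap π inferInstance]) U - h U)
                ∂(wilsonMeasure (d := 4) (L := 2 * L + 1) r.ρ β))| ≤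
      torusE G r β L (fun V => W (cfgReflect V) * W V) -
        torusE G r β L (fun V => W (cfgReflect V)) * torusE G r β L W := by
  classical
  haveI := isProbabilityMeasure_wilsonMeasure (d := 4) (L := 2 * L + 1) r.ρ r.continuous β
  haveI := r.secondCountableTopology
  have hfm : Measurable fun U : GaugeConfig 4 (2 * L + 1) G => W (torusLift (2 * L + 1) U) :=
    (hWc.comp (continuous_torusLift _)).measurable
  have hhm : Measurable h := hh.mono hπ.comap_le le_rfl
  -- `W∘lift − h` is an observable of the closed positive half
  have hfdep := dependsOn_posHalf_of_window (G := G) L hWS hSW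
  have hFdep : DependsOn (fun U : GaugeConfig 4 (2 * L + 1) G => W (torusLift (2 * L + 1) U) - h U)
      {e : Edge 4 (2 * L + 1) | (e.1 0).val ≤ L ∧ ((e.1.shift e.2) 0).val ≤ L} := by
    intro U V hUV
    have h1 := hfdep hUV
    have h2 := hdep hUV
    simp only at h1
    simp only [h1, h2]
  -- reflection positivity (uncentred) for the positive-half observable `W∘lift − h`
  have hRP : 0 ≤ ∫ U, (W (torusLift (2 * L + 1) U.negReflect) - h U.negReflect) *
      (W (torusLift (2 * L + 1) U) - h U) ∂(wilsonMeasure (d := 4) (L := 2 * L + 1) r.ρ β) :=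
    oddTorusCov_integral_negReflect_mul_self_nonneg r.ρ r.continuous hβ hL
      (fun U => W (torusLift (2 * L + 1) U) - h U) (hfm.sub hhm)
      ⟨MW + K, fun U => (abs_sub _ _).trans (add_le_add (hMW _) (hK U))⟩ (dependsOn_strictHalf_of_posHalf hL hFdep)
  have hcent' : ∫ U, h U ∂(wilsonMeasure (d := 4) (L := 2 * L + 1) r.ρ β) =
      ∫ U, W (torusLift (2 * L + 1) U) ∂(wilsonMeasure (d := 4) (L := 2 * L + 1) r.ρ β) := by
    rw [hcent]; rfl
  have key := mirror_floor_of_localiser (m := MeasurableSpace.comap π inferInstance)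
    (wilsonMeasure (d := 4) (L := 2 * L + 1) r.ρ β) hπ.comap_le
    (measurePreserving_negReflect_wilsonMeasure (d := 4) (L := 2 * L + 1) r.ρ r.continuous β)
    WilsonSiteRP.negReflect_negReflect_config
    (measurable_comap_of_equivariant π GaugeConfig.negReflect θ hθ heq)
    (f := fun U => W (torusLift (2 * L + 1) U)) hfm (fun U => hMW _) hh hK hcent' hRP
  unfold torusE
  simp only [torusLift_negReflect] at key ⊢
  exact key

/-- **The σ-algebra-free special case** (`π = id`, `g = W∘lift`): for ANY bounded measurable functional `h` of the
closed positive half of the torus `2L+1` with `∫ h dμ_T = E_T[W]`,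
`Cov_T(W∘Θ₀, W) ≥ Cov_T(h∘Θ', h) − 2·|Cov_T(h∘Θ', W∘lift − h)|` — bilinearity of the mirror form plus the RP
square `Cov_T((W∘lift − h)∘Θ', W∘lift − h) ≥ 0`. [cite: OsterwalderSeiler1978, §2] -/
theorem torus_mirror_floor_of_posHalf {β : ℝ} (hβ : 0 ≤ β) {L : ℕ} (hL : 1 ≤ L)
    {W : LGConfig 4 G → ℝ} (hWc : Continuous W) {MW : ℝ} (hMW : ∀ U, |W U| ≤ MW)
    {SW : Finset (Literature.MathematicalPhysics.QuantumLattice.ZdEdge 4)} (hWS : IsCylinder W SW)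
    (hSW : ∀ e ∈ SW, 0 ≤ e.1 0 ∧ e.1 0 + 1 ≤ (L : ℤ))
    {h : GaugeConfig 4 (2 * L + 1) G → ℝ} (hh : Measurable h) {K : ℝ} (hK : ∀ U, |h U| ≤ K)
    (hdep : DependsOn h {e : Edge 4 (2 * L + 1) | (e.1 0).val ≤ L ∧ ((e.1.shift e.2) 0).val ≤ L})
    (hcent : ∫ U, h U ∂(wilsonMeasure (d := 4) (L := 2 * L + 1) r.ρ β) = torusE G r β L W) :
    ((∫ U, h U.negReflect * h U ∂(wilsonMeasure (d := 4) (L := 2 * L + 1) r.ρ β)) -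
        (∫ U, h U.negReflect ∂(wilsonMeasure (d := 4) (L := 2 * L + 1) r.ρ β)) *
          (∫ U, h U ∂(wilsonMeasure (d := 4) (L := 2 * L + 1) r.ρ β))) -
        2 * |(∫ U, h U.negReflect * (W (torusLift (2 * L + 1) U) - h U)
              ∂(wilsonMeasure (d := 4) (L := 2 * L + 1) r.ρ β)) -
            (∫ U, h U.negReflect ∂(wilsonMeasure (d := 4) (L := 2 * L + 1) r.ρ β)) *
              (∫ U, (W (torusLift (2 * L + 1) U) - h U) ∂(wilsonMeasure (d := 4) (L := 2 * L + 1) r.ρ β))| ≤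
      torusE G r β L (fun V => W (cfgReflect V) * W V) -
        torusE G r β L (fun V => W (cfgReflect V)) * torusE G r β L W := by
  haveI := isProbabilityMeasure_wilsonMeasure (d := 4) (L := 2 * L + 1) r.ρ r.continuous β
  haveI := r.secondCountableTopology
  have hfm : Measurable fun U : GaugeConfig 4 (2 * L + 1) G => W (torusLift (2 * L + 1) U) :=
    (hWc.comp (continuous_torusLift _)).measurable
  have hfi : Integrable (fun U : GaugeConfig 4 (2 * L + 1) G => W (torusLift (2 * L + 1) U))
      (wilsonMeasure (d := 4) (L := 2 * L + 1) r.ρ β) :=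
    (integrable_const MW).mono' hfm.aestronglyMeasurable
      (Eventually.of_forall fun U => by rw [Real.norm_eq_abs]; exact hMW _)
  -- the identity coarse-graining: `π = id`, `θ = Θ'`, `σ(id) = ⊤`
  have hid : MeasurableSpace.comap (id : GaugeConfig 4 (2 * L + 1) G → GaugeConfig 4 (2 * L + 1) G)
      inferInstance = (inferInstance : MeasurableSpace (GaugeConfig 4 (2 * L + 1) G)) :=
    MeasurableSpace.comap_id
  have hh' : Measurable[MeasurableSpace.comap (id : GaugeConfig 4 (2 * L + 1) G → GaugeConfig 4 (2 * L + 1) G)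
      inferInstance] h := by rw [hid]; exact hh
  have hX : (wilsonMeasure (d := 4) (L := 2 * L + 1) r.ρ β)[fun U => W (torusLift (2 * L + 1) U)|
      MeasurableSpace.comap (id : GaugeConfig 4 (2 * L + 1) G → GaugeConfig 4 (2 * L + 1) G) inferInstance] =
        fun U => W (torusLift (2 * L + 1) U) := by
    rw [hid]; exact condExp_of_stronglyMeasurable le_rfl hfm.stronglyMeasurable hfi
  have key := torus_mirror_floor_of_localiser G r hβ hL (π := id) measurable_id (θ := GaugeConfig.negReflect)
    WilsonSiteRP.measurable_negReflect (fun U => rfl) hWc hMW hWS hSW hh' hK hdep hcent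
  rw [hX] at key
  exact key

/-- **The localisation cross term from ONE variance and ONE mean-square error** (torus instance of
`two_abs_cov_comp_le`).  For a coarse-graining `π`, a bounded `W` of the periodic lift,
a bounded measurable `h` and every `t > 0`, with `g = E_T[W∘lift | σ(π)]`:
`2·|Cov_T(h∘Θ', g − h)| ≤ t·Var_T(h) + t⁻¹·E_T[(g − h)²]` — so (LXB) is implied by a variance bound (LVB) for the
coarse localiser (UV-finite by construction) and a mean-square LOCALISATION bound (LL2) `E_T[(g − h)²] ≤ δ`
(one-observable quasi-locality of the conditional expectation given the block field); `t = √(δ/σ)` gives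
`|Cov_T(h∘Θ', g − h)| ≤ √(σδ)`.  Every coupling, every torus. [folklore] -/
theorem torus_two_abs_crossCov_le (β : ℝ) (L : ℕ) {Y : Type*} [MeasurableSpace Y]
    {π : GaugeConfig 4 (2 * L + 1) G → Y} (hπ : Measurable π)
    {W : LGConfig 4 G → ℝ} {MW : ℝ} (hMW : ∀ U, |W U| ≤ MW)
    {h : GaugeConfig 4 (2 * L + 1) G → ℝ} (hh : Measurable h) {K : ℝ} (hK : ∀ U, |h U| ≤ K)
    {t : ℝ} (ht : 0 < t) :
    2 * |(∫ U, h U.negReflect *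
            (((wilsonMeasure (d := 4) (L := 2 * L + 1) r.ρ β)[fun U => W (torusLift (2 * L + 1) U)|
                MeasurableSpace.comap π inferInstance]) U - h U)
            ∂(wilsonMeasure (d := 4) (L := 2 * L + 1) r.ρ β)) -
          (∫ U, h U.negReflect ∂(wilsonMeasure (d := 4) (L := 2 * L + 1) r.ρ β)) *
            (∫ U, (((wilsonMeasure (d := 4) (L := 2 * L + 1) r.ρ β)[fun U => W (torusLift (2 * L + 1) U)|
                MeasurableSpace.comap π inferInstance]) U - h U)
              ∂(wilsonMeasure (d := 4) (L := 2 * L + 1) r.ρ β))| ≤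
      t * ((∫ U, h U * h U ∂(wilsonMeasure (d := 4) (L := 2 * L + 1) r.ρ β)) -
            (∫ U, h U ∂(wilsonMeasure (d := 4) (L := 2 * L + 1) r.ρ β)) *
              (∫ U, h U ∂(wilsonMeasure (d := 4) (L := 2 * L + 1) r.ρ β))) +
        t⁻¹ * ∫ U, (((wilsonMeasure (d := 4) (L := 2 * L + 1) r.ρ β)[fun U => W (torusLift (2 * L + 1) U)|
            MeasurableSpace.comap π inferInstance]) U - h U) ^ 2
          ∂(wilsonMeasure (d := 4) (L := 2 * L + 1) r.ρ β) := by
  haveI := isProbabilityMeasure_wilsonMeasure (d := 4) (L := 2 * L + 1) r.ρ r.continuous β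
  haveI := r.secondCountableTopology
  have hg_aesm : AEStronglyMeasurable
      ((wilsonMeasure (d := 4) (L := 2 * L + 1) r.ρ β)[fun U => W (torusLift (2 * L + 1) U)|
        MeasurableSpace.comap π inferInstance]) (wilsonMeasure (d := 4) (L := 2 * L + 1) r.ρ β) :=
    (stronglyMeasurable_condExp.mono hπ.comap_le).aestronglyMeasurable
  have hg_bdd : ∀ᵐ U ∂(wilsonMeasure (d := 4) (L := 2 * L + 1) r.ρ β),
      |((wilsonMeasure (d := 4) (L := 2 * L + 1) r.ρ β)[fun U => W (torusLift (2 * L + 1) U)|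
        MeasurableSpace.comap π inferInstance]) U| ≤ MW :=
    ae_bdd_abs_condExp_of_ae_bdd_abs (Eventually.of_forall fun U => hMW _)
  have hD_aesm := hg_aesm.sub hh.aestronglyMeasurable
  have hD_bdd : ∀ᵐ U ∂(wilsonMeasure (d := 4) (L := 2 * L + 1) r.ρ β),
      |((wilsonMeasure (d := 4) (L := 2 * L + 1) r.ρ β)[fun U => W (torusLift (2 * L + 1) U)|
        MeasurableSpace.comap π inferInstance]) U - h U| ≤ MW + K :=
    hg_bdd.mono fun U hU => (abs_sub _ _).trans (add_le_add hU (hK U))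
  exact two_abs_cov_comp_le (wilsonMeasure (d := 4) (L := 2 * L + 1) r.ρ β)
    (measurePreserving_negReflect_wilsonMeasure (d := 4) (L := 2 * L + 1) r.ρ r.continuous β)
    WilsonSiteRP.negReflect_negReflect_config hh hK hD_aesm hD_bdd ht

end Torus

end Summit.QuantumFields.YangMills.Cruxes.NT.MirrorSplit

end
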